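import Literature.AlgebraicGeometry.Resolution.FormalFibresRegularProofs
import Literature.RingTheory.CompleteLocalRings.CoefficientField
import Mathlib.RingTheory.MvPowerSeries.Basic
import Mathlib.RingTheory.Ideal.Operations
import HarnessLib

/-!
# Crux `Steer` (stmt-ResolutionOfSingularities-16345), chain W4.1 — hK4ⁿᶜ β-leaf TRANSPORT BRICK, part 1:
# COHEN COORDINATES of an abstract complete regular local ring on a CHOSEN regular system of parameters, and
# «monomial ideals of `R⟦X_σ⟧` are support conditions»

OURS (campaign `res-hironaka`, rung L ★L-G4, slot W4.1; seat res-L0-w41-stub-4 g7 on res-L0-w41-plan-1 RULING 172a «THEN: TRANSPORT brick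
GO»; it makes the (C1) canonical-cleaning kernel (`…BetaPolygonCanonicalCleaning`, p543008) and the β-line words (`…BetaPolygonWords` /
`…BetaPolygonGauge`) meet: over an `IsHatRing`-type member `S` (complete regular local, perfect residue field) with r.s.o.p. `(x, y, z, w)`
the threshold ideals become SUPPORT CONDITIONS in `κ⟦X₀, X₁, X₂, X₃⟧`). Replaces the role of no printed item; NOT a statement of the
manuscript under review [claim: Hironaka2017, status: under-review]; AI-produced, weaker than expert review. Theses-free, definition-free.

* **`exists_ringEquiv_mvPowerSeries_of_rsop`** — Matsumura 29.7 with CHOSEN parameters for an ABSTRACT complete regular local ring `A`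
  of prime characteristic `p`: for generators `z₁, …, z_d` of `𝔪` (`d = emb dim A`) there is `e : A ≃+* κ⟦X₁, …, X_d⟧`, `κ` the residue
  field of `A`, with `e zᵢ = Xᵢ` and `constantCoeff (e a) = residue a`. (The tree has the `AdicCompletion` form with chosen parameters,
  `…Core4IsoChartZero.exists_ringEquiv_adicCompletion_constantCoeff`, and the parameter-free complete form
  `Literature…exists_ringEquiv_mvPowerSeries_residueField`; this is the complete form WITH parameters, same proof: coefficient field through
  the prime field `𝔽_p` (Matsumura 28.3 (ii)), substitution map `exists_adicEvalHom`, bijectivity `comp_map_bijective`.)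
* **`mem_span_monomial_iff`** — for a finite set `E` of exponents, `F ∈ (X^e : e ∈ E)` iff every monomial of `F` is divisible by some
  `X^e`, `e ∈ E` (⇐ by an explicit partition of the support); `mem_span_monomial_iff'` (the «`∀ m ∉ U, coeff m F = 0`» phrasing that the
  (C1) lemmas consume); `coeff_mul_eq_zero_of_forall_coeff_eq_zero` (series supported on an up-set form an ideal);
  `span_monomial_mul_span_monomial`, `span_monomial_sup_span_monomial`, `span_singleton_monomial_eq` (products / sums / singletons of
  monomial spans are monomial spans).

[cite: Matsumura1987, Thm. 28.3 (ii), Thm. 29.7] [folklore]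
bears_on: LADDER-RESOLUTION L ★L-G4 W4.1 (crux `Steer`, binder hK4ⁿᶜ, transport for (C1) / brick I).
-/

noncomputable section

-- `Summit.<S>.<S>.…` duplicates the summit name by design (single-problem summit).
set_option linter.dupNamespace false

open MvPowerSeries IsLocalRing
open Literature.AlgebraicGeometry.Resolution

namespace Summit.ResolutionOfSingularities.ResolutionOfSingularities.Theorems.SwitchingDichotomy.CanonicalCleaning

universe u v

/-! ## §1 Cohen coordinates on a chosen regular system of parameters (abstract complete regular local ring) -/

/-- **Cohen coordinates with CHOSEN parameters, abstract complete form** (Matsumura 29.7 + 28.3 (ii)). Let `A` be a COMPLETE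
regular local ring of prime characteristic `p`, `d = emb dim A`, and `z₁, …, z_d` generators of `𝔪_A`. Then there is a ring
isomorphism `e : A ≃+* κ⟦X₁, …, X_d⟧` (`κ` the residue field of `A`) with `e zᵢ = Xᵢ` and `constantCoeff (e a) = residue a`.
[cite: Matsumura1987, Thm. 29.7] -/
theorem exists_ringEquiv_mvPowerSeries_of_rsop (p : ℕ) [Fact p.Prime] (A : Type u) [CommRing A]
    [IsRegularLocalRing A] [IsAdicComplete (maximalIdeal A) A] [CharP A p] {d : ℕ}
    (hd : (maximalIdeal A).spanFinrank = d) (z : Fin d → A) (hz : Ideal.span (Set.range z) = maximalIdeal A) :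
    ∃ e : A ≃+* MvPowerSeries (Fin d) (ResidueField A),
      (∀ i, e (z i) = X i) ∧ ∀ a, constantCoeff (e a) = residue A a := by
  letI : Algebra (ZMod p) A := ZMod.algebra A p
  -- a coefficient field: a section `σ` of the residue map
  obtain ⟨σ, hσ⟩ := Literature.RingTheory.CompleteLocalRings.exists_ringHom_comp_residue_eq_id A (ZMod p)
  have hzm : ∀ i, z i ∈ maximalIdeal A := fun i => hz ▸ Ideal.subset_span ⟨i, rfl⟩
  -- the expansion map `κ⟦X⟧ → A`, `Xᵢ ↦ zᵢ`, coefficients through `σ`, is bijective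
  obtain ⟨Φ, hΦ₁, hΦ₂⟩ := exists_adicEvalHom (maximalIdeal A) z hzm
  have hbij := comp_map_bijective σ hσ hd z hz Φ hΦ₁ hΦ₂
  let e₀ : A ≃+* MvPowerSeries (Fin d) (ResidueField A) := (RingEquiv.ofBijective _ hbij).symm
  have happly : ∀ g, e₀.symm g = Φ (MvPowerSeries.map σ g) := fun g => rfl
  refine ⟨e₀, fun i => ?_, fun a => ?_⟩
  · apply e₀.symm.injective
    rw [RingEquiv.symm_apply_apply, happly, MvPowerSeries.map_X, ← MvPolynomial.coe_X, hΦ₁, MvPolynomial.eval_X]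
  · set g := e₀ a with hg
    have ha : a = Φ (MvPowerSeries.map σ g) := by rw [← happly, hg, RingEquiv.symm_apply_apply]
    have hC : Φ (MvPowerSeries.map σ (C (constantCoeff g))) = σ (constantCoeff g) := by
      rw [MvPowerSeries.map_C, ← MvPolynomial.coe_C, hΦ₁, MvPolynomial.eval_C]
    have hmem : a - σ (constantCoeff g) ∈ maximalIdeal A := by
      rw [ha, ← hC, ← map_sub, ← map_sub, ← pow_one (maximalIdeal A)]
      refine hΦ₂ 1 _ fun x hx => ?_
      have hx0 : x = 0 := by
        have : x.degree = 0 := Nat.lt_one_iff.mp hx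
        exact (Finsupp.degree_eq_zero_iff x).mp this
      subst hx0
      rw [MvPowerSeries.coeff_map, map_sub, MvPowerSeries.coeff_C, if_pos rfl,
        MvPowerSeries.coeff_zero_eq_constantCoeff_apply, sub_self, map_zero]
    have hres : residue A a - residue A (σ (constantCoeff g)) = 0 := by
      rw [← map_sub, IsLocalRing.residue_eq_zero_iff]
      exact hmem
    rw [sub_eq_zero, hσ] at hres
    exact hres.symm

/-- The same for FOUR named parameters `x, y, z, w` (the β-line's `IsHatRing` members): `e x = X 0`, `e y = X 1`, `e z = X 2`,
`e w = X 3`. [cite: Matsumura1987, Thm. 29.7] -/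
theorem exists_ringEquiv_mvPowerSeries_four (p : ℕ) [Fact p.Prime] (A : Type u) [CommRing A]
    [IsRegularLocalRing A] [IsAdicComplete (maximalIdeal A) A] [CharP A p]
    (hd : (maximalIdeal A).spanFinrank = 4) (x y z w : A) (hspan : Ideal.span {x, y, z, w} = maximalIdeal A) :
    ∃ e : A ≃+* MvPowerSeries (Fin 4) (ResidueField A),
      e x = X 0 ∧ e y = X 1 ∧ e z = X 2 ∧ e w = X 3 ∧ ∀ a, constantCoeff (e a) = residue A a := by
  have hrange : Set.range ![x, y, z, w] = {x, y, z, w} := by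
    ext a
    simp only [Set.mem_range, Set.mem_insert_iff, Set.mem_singleton_iff]
    constructor
    · rintro ⟨j, rfl⟩; fin_cases j <;> simp
    · rintro (rfl | rfl | rfl | rfl)
      exacts [⟨0, rfl⟩, ⟨1, rfl⟩, ⟨2, rfl⟩, ⟨3, rfl⟩]
  obtain ⟨e, he, hc⟩ := exists_ringEquiv_mvPowerSeries_of_rsop p A hd ![x, y, z, w] (by rw [hrange, hspan])
  exact ⟨e, he 0, he 1, he 2, he 3, hc⟩

/-! ## §2 Monomial ideals of `R⟦X_σ⟧` are support conditions -/

section MonomialSpan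

variable {σ : Type u} {R : Type v} [CommRing R]

/-- The series supported on an UP-SET `U` of exponents form an ideal: if every monomial of `F` outside `U` vanishes, the
same holds for `G * F`. [folklore] -/
theorem coeff_mul_eq_zero_of_forall_coeff_eq_zero {U : Set (σ →₀ ℕ)} (hU : ∀ ⦃m m' : σ →₀ ℕ⦄, m ∈ U → m ≤ m' → m' ∈ U)
    (G : MvPowerSeries σ R) {F : MvPowerSeries σ R} (hF : ∀ m ∉ U, coeff m F = 0) {m : σ →₀ ℕ} (hm : m ∉ U) :
    coeff m (G * F) = 0 := by
  classical
  rw [coeff_mul]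
  refine Finset.sum_eq_zero fun p hp => ?_
  rw [Finset.mem_antidiagonal] at hp
  have : p.2 ∉ U := fun h2 => hm (hU h2 (hp ▸ le_add_self))
  rw [hF _ this, mul_zero]

/-- **Monomial ideals of `R⟦X_σ⟧` are support conditions**: for a finite set `E` of exponents,
`F ∈ (X^e : e ∈ E)` iff every monomial of `F` is divisible by some `X^e`, `e ∈ E`. [folklore] -/
theorem mem_span_monomial_iff (E : Finset (σ →₀ ℕ)) (F : MvPowerSeries σ R) :
    F ∈ Ideal.span ((fun e => monomial e (1 : R)) '' (E : Set (σ →₀ ℕ))) ↔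
      ∀ m, coeff m F ≠ 0 → ∃ e ∈ E, e ≤ m := by
  classical
  constructor
  · -- the support ideal of the up-set `U = {m | ∃ e ∈ E, e ≤ m}` contains the generators
    intro hF
    let J : Ideal (MvPowerSeries σ R) :=
      { carrier := {G | ∀ m, (¬ ∃ e ∈ E, e ≤ m) → coeff m G = 0}
        add_mem' := fun {a b} ha hb m hm => by rw [map_add, ha m hm, hb m hm, add_zero]
        zero_mem' := fun m _ => by simp
        smul_mem' := fun c a ha m hm => by
          rw [smul_eq_mul]
          exact coeff_mul_eq_zero_of_forall_coeff_eq_zero (U := {m | ∃ e ∈ E, e ≤ m})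
            (fun m m' ⟨e, he, hle⟩ hmm' => ⟨e, he, hle.trans hmm'⟩) c (fun m hm => ha m hm) hm }
    have hle : Ideal.span ((fun e => monomial e (1 : R)) '' (E : Set (σ →₀ ℕ))) ≤ J := by
      rw [Ideal.span_le]
      rintro _ ⟨e, he, rfl⟩ m hm
      rw [coeff_monomial, if_neg]
      intro hme
      exact hm ⟨e, he, hme ▸ le_rfl⟩
    intro m hm
    by_contra h
    exact hm (hle hF m h)
  · intro h
    -- choose, for each exponent in the support, a divisor from `E`
    let pick : (σ →₀ ℕ) → (σ →₀ ℕ) := fun m => if hx : ∃ e ∈ E, e ≤ m then Classical.choose hx else 0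
    have hpick : ∀ m, (∃ e ∈ E, e ≤ m) → pick m ∈ E ∧ pick m ≤ m := fun m hx => by
      simp only [pick, dif_pos hx]; exact Classical.choose_spec hx
    -- the cofactor of `X^e`
    let G : (σ →₀ ℕ) → MvPowerSeries σ R := fun e m' => if pick (m' + e) = e then coeff (m' + e) F else 0
    have hdec : F = ∑ e ∈ E, monomial e (1 : R) * G e := by
      ext m
      rw [map_sum]
      simp only [coeff_monomial_mul, one_mul]
      by_cases hx : ∃ e ∈ E, e ≤ m
      · obtain ⟨hpE, hple⟩ := hpick m hx
        rw [Finset.sum_eq_single (pick m)]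
        · rw [if_pos hple]
          change coeff m F = if pick (m - pick m + pick m) = pick m then coeff (m - pick m + pick m) F else 0
          rw [tsub_add_cancel_of_le hple, if_pos rfl]
        · intro e _ hne
          split_ifs with hle
          · change (if pick (m - e + e) = e then coeff (m - e + e) F else 0) = 0
            rw [tsub_add_cancel_of_le hle, if_neg (Ne.symm hne)]
          · rfl
        · intro hnot; exact absurd hpE hnot
      · have hF0 : coeff m F = 0 := by
          by_contra hne; exact hx (h m hne)
        rw [hF0, eq_comm]
        refine Finset.sum_eq_zero fun e he => ?_
        split_ifs with hle
        · change (if pick (m - e + e) = e then coeff (m - e + e) F else 0) = 0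
          rw [tsub_add_cancel_of_le hle]
          exact (hx ⟨e, he, hle⟩).elim
        · rfl
    rw [hdec]
    exact Submodule.sum_mem _ fun e he => Ideal.mul_mem_right _ _ (Ideal.subset_span ⟨e, by exact_mod_cast he, rfl⟩)

/-- The support-condition form with the «vanishing outside the up-set» phrasing used by the (C1) lemmas:
`F ∈ (X^e : e ∈ E) ↔ ∀ m ∉ {m | ∃ e ∈ E, e ≤ m}, coeff m F = 0`. [folklore] -/
theorem mem_span_monomial_iff' (E : Finset (σ →₀ ℕ)) (F : MvPowerSeries σ R) :
    F ∈ Ideal.span ((fun e => monomial e (1 : R)) '' (E : Set (σ →₀ ℕ))) ↔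
      ∀ m ∉ {m : σ →₀ ℕ | ∃ e ∈ E, e ≤ m}, coeff m F = 0 := by
  rw [mem_span_monomial_iff]
  refine forall_congr' fun m => ?_
  rw [Set.mem_setOf_eq]
  constructor
  · intro h hn; by_contra hF; exact hn (h hF)
  · intro h hF; by_contra hn; exact hF (h hn)

/-- Products of monomial spans: `(X^a : a ∈ A) · (X^b : b ∈ B) = (X^(a+b) : a ∈ A, b ∈ B)`. [folklore] -/
theorem span_monomial_mul_span_monomial [DecidableEq σ] (A B : Finset (σ →₀ ℕ)) :
    Ideal.span ((fun e => monomial e (1 : R)) '' (A : Set (σ →₀ ℕ))) *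
        Ideal.span ((fun e => monomial e (1 : R)) '' (B : Set (σ →₀ ℕ))) =
      Ideal.span ((fun e => monomial e (1 : R)) '' ((Finset.image₂ (· + ·) A B : Finset (σ →₀ ℕ)) : Set (σ →₀ ℕ))) := by
  rw [Ideal.span_mul_span']
  congr 1
  ext g
  simp only [Set.mem_mul, Set.mem_image, Finset.coe_image₂, Set.mem_image2, Finset.mem_coe]
  constructor
  · rintro ⟨_, ⟨a, ha, rfl⟩, _, ⟨b, hb, rfl⟩, rfl⟩
    exact ⟨a + b, ⟨a, ha, b, hb, rfl⟩, by rw [monomial_mul_monomial, one_mul]⟩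
  · rintro ⟨_, ⟨a, ha, b, hb, rfl⟩, rfl⟩
    exact ⟨_, ⟨a, ha, rfl⟩, _, ⟨b, hb, rfl⟩, by rw [monomial_mul_monomial, one_mul]⟩

/-- Sums of monomial spans: `(X^a : a ∈ A) + (X^b : b ∈ B) = (X^e : e ∈ A ∪ B)`. [folklore] -/
theorem span_monomial_sup_span_monomial [DecidableEq (σ →₀ ℕ)] (A B : Finset (σ →₀ ℕ)) :
    Ideal.span ((fun e => monomial e (1 : R)) '' (A : Set (σ →₀ ℕ))) ⊔
        Ideal.span ((fun e => monomial e (1 : R)) '' (B : Set (σ →₀ ℕ))) =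
      Ideal.span ((fun e => monomial e (1 : R)) '' ((A ∪ B : Finset (σ →₀ ℕ)) : Set (σ →₀ ℕ))) := by
  rw [← Ideal.span_union, ← Set.image_union, Finset.coe_union]

/-- A single monomial: `(X^e) = span of the image of `{e}`. [folklore] -/
theorem span_singleton_monomial_eq (e : σ →₀ ℕ) :
    Ideal.span {monomial e (1 : R)} = Ideal.span ((fun e => monomial e (1 : R)) '' (({e} : Finset (σ →₀ ℕ)) : Set (σ →₀ ℕ))) := by
  rw [Finset.coe_singleton, Set.image_singleton]

end MonomialSpan

end Summit.ResolutionOfSingularities.ResolutionOfSingularities.Theorems.SwitchingDichotomy.CanonicalCleaning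

end
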